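import Summits.Ventures.KdS.ClosedHalfPlane
import Summits.Ventures.KdS.ScalarUpgradeB0
import Literature.Geometry.Lorentzian.KerrDeSitterZeroFrequencyScalarModes
import HarnessLib

/-!
# Venture KdS — the conformally coupled scalar (`s = 0`, `μ = 1`) on the closed half-plane WITHOUT
# cited hypotheses

HONEST FRAMING (venture `Summits/Ventures/KdS`, cell `pub-kds`, seat P1): theorems only (no definitions,
no named facts). The hypothesis-free scalar column of `SharpWindows.lean` (`msTruncScalarU_of`: windows
containing the disc `|ω| < |m|ϖ₁`, strictly growing modes) is extended to the CLOSED upper half-plane —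
real frequencies and `ω = 0` included — using ONLY the tree's kernel theorems for Casals–Teixeira da
Costa 2022, proof of Thm 3.10, Step 1 and its real-frequency / zero-frequency forms:
`hasMode_zero_window'` (`KerrDeSitterRadialEnergyIdentity.lean`), `not_hasMode_zero_real`
(`KerrDeSitterRealFrequencyModes.lean`) and `not_hasMode_zeroFreq`
(`KerrDeSitterZeroFrequencyScalarModes.lean`, every `m` at `ω = 0`). RESULT:
`msTruncClosedScalar_of_windowU : WindowConstantsScalarU B T → 0 ≤ η → StatementBbarScalar B T η Λs →
MSTruncClosedScalar B T Λs` (statement shape of `ClosedHalfPlane.lean`): the scalar certificates ALONE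
give «no `s = 0` (`μ = 1`) mode with `Im ω ≥ 0`, `|m| ≤ M0`, and `λ ∈ Λs` whenever `ω` lies in the
closed scalar window» on every box whose scalar windows contain the disc `|ω| < |m|ϖ₁`; on the pilot
box `msTruncClosedScalarU_B0` (table `tableB0u`, A26′ runs 7u/8u). NO residual point remains for this
column at `|m| ≤ M0` beyond the λ-truncation inside the windows. No claim about `s ≠ 0`, `|m| > M0`,
the massless scalar `μ = 0` (whose constants ARE `ω = m = 0` modes, `hasMasterMode_wave_zeroFreq`), or
nonlinear stability.

References: M. Casals, R. Teixeira da Costa, Commun. Math. Phys. 394 (2022) 797–832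
[CasalsTeixeiradacosta2022], Thm 3.10 (proof, Step 1); cell HOME `run/shared/lean/pub/pub-kds/`
(PLAN A26′, VENTURE-STATEMENT (S-B0-u), (S-R)).
-/

noncomputable section

open Set Complex

namespace Summit.Ventures.KdS

open Literature.Geometry.Lorentzian Literature.Geometry.Lorentzian.KerrDeSitter

/-! ### Off the U-window on the real axis -/

/-- `0 ≤ ϖ₂ ≤ ϖ₁` (`ϖ_j = a/(r_j² + a²)`, `0 < r₊ < r_c`, `0 ≤ a`). -/
theorem horizonAngVel_rCosmo_le {M a Λ : ℝ} (hsub : IsSubextremal M a Λ) (ha : 0 ≤ a) :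
    0 ≤ horizonAngVel a (rCosmo M a Λ) ∧
      horizonAngVel a (rCosmo M a Λ) ≤ horizonAngVel a (rPlus M a Λ) := by
  obtain ⟨-, -, h01, h12, -⟩ := hsub
  have h1 : 0 < rPlus M a Λ := lt_of_le_of_lt (rMinus_nonneg M a Λ) h01
  unfold horizonAngVel
  refine ⟨div_nonneg ha (by positivity), ?_⟩
  apply div_le_div_of_nonneg_left ha (by positivity)
  nlinarith

/-- Off the U-window on the real axis, hypothesis-free: a REAL frequency with `|Re ω| > R ≥ |m|ϖ₁`, or
with `m = 0`, `ω ≠ 0`, carries no `s = 0` (`μ = 1`) mode — `(Re ω − mϖ₁)(Re ω − mϖ₂) ≥ 0` there, so the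
tree's `not_hasMode_zero_real` (CTdC 2022 Thm 3.10 Step 1, real case) applies. -/
theorem not_hasMode_zero_real_offWindow {M a Λ : ℝ} {ω : ℂ} {m R : ℝ} (hsub : IsSubextremal M a Λ)
    (ha : 0 ≤ a) (hω : ω.im = 0) (hRm : |m| * horizonAngVel a (rPlus M a Λ) ≤ R)
    (hoff : m = 0 ∧ ω ≠ 0 ∨ R < |ω.re|) : ¬HasMode M a Λ 0 ω m := by
  obtain ⟨hϖ2, hϖ21⟩ := horizonAngVel_rCosmo_le hsub ha
  set ϖ1 := horizonAngVel a (rPlus M a Λ)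
  set ϖ2 := horizonAngVel a (rCosmo M a Λ)
  rcases hoff with ⟨hm0, hω0⟩ | hR
  · refine not_hasMode_zero_real hsub hω hω0 ?_
    rw [hm0, zero_mul, zero_mul, sub_zero]
    exact mul_self_nonneg _
  · have hR0 : 0 ≤ R := (mul_nonneg (abs_nonneg m) (hϖ2.trans hϖ21)).trans hRm
    have hω0 : ω ≠ 0 := by
      intro h; rw [h, Complex.zero_re, abs_zero] at hR; linarith
    refine not_hasMode_zero_real hsub hω hω0 ?_
    have h1 : |m * ϖ1| < |ω.re| := by
      rw [abs_mul, abs_of_nonneg (hϖ2.trans hϖ21)]; exact hRm.trans_lt hR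
    have h2 : |m * ϖ2| < |ω.re| := by
      rw [abs_mul, abs_of_nonneg hϖ2]
      exact (mul_le_mul_of_nonneg_left hϖ21 (abs_nonneg m)).trans hRm |>.trans_lt hR
    rcases le_or_gt 0 ω.re with hpos | hneg
    · rw [abs_of_nonneg hpos] at h1 h2
      have e1 : 0 < ω.re - m * ϖ1 := by linarith [le_abs_self (m * ϖ1)]
      have e2 : 0 < ω.re - m * ϖ2 := by linarith [le_abs_self (m * ϖ2)]
      exact (mul_pos e1 e2).le
    · rw [abs_of_neg hneg] at h1 h2
      have e1 : ω.re - m * ϖ1 < 0 := by linarith [neg_abs_le (m * ϖ1)]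
      have e2 : ω.re - m * ϖ2 < 0 := by linarith [neg_abs_le (m * ϖ2)]
      exact (mul_pos_of_neg_of_neg e1 e2).le

/-! ### The hypothesis-free scalar column on the closed half-plane -/

/-- **MS_trunc on the CLOSED half-plane, scalar column (`s = 0`, `μ = 1`), from the certificates ALONE.**
From (H4u) (`WindowConstantsScalarU`: subextremal, `a > 0`, the scalar windows contain the disc
`|ω| < |m|ϖ₁`) and the scalar certificates' Statement B̄ (`η ≥ 0`) — no cited fact —:
`MSTruncClosedScalar B T Λs`, i.e. for every `(M, a, Λ) ∈ B` no mode with `Im ω ≥ 0` (real axis and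
`ω = 0` included), `|m| ≤ M0`, and `λ ∈ Λs` whenever `ω` lies in the closed scalar window. Off the
window: `Im ω > 0` by `hasMode_zero_window'` (via `statementAScalar_of_window`), `ω = 0` by
`not_hasMode_zeroFreq`, real `ω ≠ 0` by `not_hasMode_zero_real_offWindow`; in the closed window: the
certificates. -/
theorem msTruncClosedScalar_of_windowU {B : Set (ℝ × ℝ × ℝ)} {T : WindowTable} {η : ℝ}
    {Λs : ℝ → ℝ → ℂ → ℝ → Set ℂ} (h4u : WindowConstantsScalarU B T) (hη : 0 ≤ η)
    (hB : StatementBbarScalar B T η Λs) : MSTruncClosedScalar B T Λs := by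
  have hA := statementAScalar_of_window h4u
  intro p hp ω m hq hk lam hlam R hR
  obtain ⟨him, hm⟩ := hq
  obtain ⟨hsub, hapos, hconst⟩ := h4u p hp
  by_cases hw : ω ∈ windowClosedScalar T m
  · exact hB p hp ω m ⟨hm, windowClosedScalar_subset_windowBarScalar T hη m hw⟩ hk lam (hlam hw) R hR
  · rcases him.lt_or_eq with hpos | hzero
    · have hw' : ω ∉ windowScalar T m := fun h => hw (windowScalar_subset_windowClosedScalar T m h)
      exact hA p hp ω m ⟨hpos, hm, hw'⟩ hk ⟨lam, R, hR⟩
    · by_cases hω0 : ω = 0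
      · subst hω0
        exact not_hasMode_zeroFreq hsub m ⟨lam, R, hR⟩
      · by_cases hm0 : m = 0
        · exact not_hasMode_zero_real_offWindow (R := 0) hsub hapos.le hzero.symm
            (by rw [hm0, abs_zero, zero_mul]) (Or.inl ⟨hm0, hω0⟩) ⟨lam, R, hR⟩
        · obtain ⟨hRm, hhm⟩ := hconst m hm hm0
          have hϖ0 : 0 ≤ |m| * horizonAngVel p.2.1 (rPlus p.1 p.2.1 p.2.2) :=
            mul_nonneg (abs_nonneg m) ((horizonAngVel_rCosmo_le hsub hapos.le).1.trans
              (horizonAngVel_rCosmo_le hsub hapos.le).2)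
          have hre : T.R m < |ω.re| := by
            by_contra hle
            exact hw ⟨hm0, not_lt.mp hle, him, by rw [← hzero]; exact hϖ0.trans hhm⟩
          exact not_hasMode_zero_real_offWindow hsub hapos.le hzero.symm hRm (Or.inr hre)
            ⟨lam, R, hR⟩

/-- **B0, hypothesis-free, closed half-plane** (upgrade table `tableB0u`, A26′): the scalar certificates'
Statement B̄ on the U-windows ALONE give `MSTruncClosedScalar B0 tableB0u Λs` — no cited fact; the
real axis and `ω = 0` included, no residual point. -/
theorem msTruncClosedScalarU_B0 {Λs : ℝ → ℝ → ℂ → ℝ → Set ℂ}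
    (hB : StatementBbarScalar B0 tableB0u (1 / 125) Λs) : MSTruncClosedScalar B0 tableB0u Λs :=
  msTruncClosedScalar_of_windowU windowConstantsScalarU_B0 (by norm_num) hB

section WaveU

variable {ts : List CertTile}

/-- **Hypothesis-free closed scalar MS_trunc on every tile whose scalar window contains the disc
`|ω| < |m|ϖ₁`** (the closed twin of `msTruncScalarU_atlas`). -/
theorem msTruncClosedScalarU_atlas (hU : ∀ t ∈ ts, WindowConstantsScalarU t.tile.box t.T)
    (hη : ∀ t ∈ ts, 0 ≤ t.eta) (hdata : ∀ t ∈ ts, t.DataScalar) :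
    ∀ t ∈ ts, MSTruncClosedScalar t.tile.box t.T t.lamScalar :=
  fun t ht => msTruncClosedScalar_of_windowU (hU t ht) (hη t ht) (t.statementBbarScalar (hdata t ht))

end WaveU

end Summit.Ventures.KdS

end
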